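import Literature.NumberTheory.LFunctions.NicolasDivisorFunctionCriterion
import Literature.NumberTheory.LFunctions.NicolasJExplicit
import HarnessLib

/-!
# RH-FREE (plus the RH bounds (1.4), (1.6)) · Nicolas 2022, Lemma 2.5: the zero sum `S(t) = ∑_ρ t^ρ/ρ²` of the highly-composite-numbers criterion through `ψ`; nothing here bears on the truth of RH

Literature-typing tranche `rh-lit-broughan-1` (Broughan, *Equivalents of the Riemann Hypothesis*
vol. 3, CUP 2023, ch. 2 "Nicolas' number of divisors function equivalence" — the volume is NOT held;
PRIMARY source read: J.-L. Nicolas, *Highly composite numbers and the Riemann hypothesis*,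
Ramanujan J. 57 (2022) 507–550, author's preprint `hcnHR.pdf`, §1 (1.3)–(1.6) and §2.3 Lemmas
2.3, 2.5). Everything in this file is PROVED (theorems only; no named facts).

The tree's `NicolasDivisorFunctionCriterion.lean` typed Nicolas's criterion with the zero sum
`Nicolas2022.S t = ∑_ρ m(ρ) t^ρ/ρ²` (a `tsum` over the non-trivial zeros, multiplicities `m`) and
`Nicolas2022.R t = (2√t + Re S(t))/log² t` ((1.3)), but proved nothing about `S`. Here:

* `Nicolas2022.summable_norm_sTerm` — RH-FREE absolute convergence of `S(t)` (`t ≥ 1`), from the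
  RH-free `∑ m(ρ)/|ρ|² < ∞` (`Nicolas2022.summable_zeroOrder_div_norm_sq`).
* `Nicolas2022.S_eq_Zsum` — RH-FREE: for `x ≥ 1`,
  `S(x) = Z(x)/x + ∫₁^x Z(t)/t² dt + ∑_ρ m(ρ)/(ρ²(ρ+1))`, where `Z(t) = ∑_ρ m(ρ) t^{ρ+1}/(ρ(ρ+1))`
  is the (absolutely convergent) zero sum of the explicit formula for `ψ₁` (tree:
  `NicolasJExplicit.Zsum`, `psiOne_eq_explicit`). Per zero this is
  `x^ρ/ρ² = x^ρ/(ρ(ρ+1)) + ∫₁^x t^{ρ−1} dt/(ρ(ρ+1)) + 1/(ρ²(ρ+1))`; the interchange of `∑_ρ` and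
  `∫₁^x` is dominated convergence (`|t^{ρ+1}| ≤ x²` on `[1, x]`).
* `Nicolas2022.re_S_eq` — **Lemma 2.5 (2.19)**, real part, in the form
  `Re S(x) = ∫₁^x (1 − ψ(t)/t) dt − log(2π)·log x + c₀ + E₁(x)` (`x ≥ 1`) with an absolute constant
  `c₀ = 1/2 − log 2π + Re ∑_ρ m(ρ)/(ρ²(ρ+1))` and `E₁(x) = Re E(x)/x + ∫₁^x Re E(t)/t² dt` built from
  the remainder `E(x) = O(√x)` of the `ψ₁` formula (tree: `psiOneRemainder`,
  `exists_norm_psiOneRemainder_le`); `Nicolas2022.exists_abs_sErr_le`: `|E₁(x)| ≤ K` for `x ≥ 1`.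
  (Nicolas's printed (2.19) has the exact constant `τ₂ + π²/24` and the trivial-zero series
  `−∑_j x^{−2j}/(4j²)` in place of `c₀ + E₁(x)`; his route is termwise integration of the
  conditionally convergent explicit formula for `ψ` — Lemma 2.3 = Ellison Thm. 5.8 (b) — ours the
  absolutely convergent formula for `ψ₁`, which is what the tree holds. The `O(1)` form is all that
  §§2–4 of the paper use. `S(t)` is real by conjugation symmetry; only `Re S` enters `R`.)
* Under RH: `Nicolas2022.norm_S_le_of_RH` — **(1.4)** `|S(t)| ≤ τ√t` (`τ = ∑_ρ 1/|ρ|² =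
  2 + γ − log 4π`, the tree's `nicolasBeta`, `hasSum_zeroOrder_div_norm_sq_of_RH`);
  `Nicolas2022.R_le_of_RH`, `Nicolas2022.le_R_of_RH` — **(1.6)**
  `(2−τ)√t/log²t ≤ R(t) ≤ (2+τ)√t/log² t`; and `Nicolas2022.exists_abs_primeIntegral_le_of_RH` —
  `|∫₁^x (1 − ψ(t)/t) dt| ≤ τ√x + log(2π) log x + K` (`x ≥ 1`).
* RH-FREE calculus of `I(x) = ∫₁^x (1 − ψ(t)/t) dt` (`Nicolas2022.primeIntegral`): continuity,
  right derivative `1 − ψ(x)/x`, and `|I(y) − I(x)| ≤ M (y − x)` whenever `|1 − ψ/t| ≤ M` on `[x, y]`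
  (the input of Nicolas's Lemma 2.7 (2.21)–(2.23)).

These are the RH-free handles on `S` and `R` needed by kernel work on Theorem 1.1 of the paper.

## References

* J.-L. Nicolas, *Highly composite numbers and the Riemann hypothesis*, Ramanujan J. 57 (2022)
  507–550, (1.3)–(1.6), Lemma 2.3, Def. 2.4, Lemma 2.5 (2.19)–(2.20). [Nicolas2022HC]
* H. L. Montgomery, R. C. Vaughan, *Multiplicative Number Theory I*, CUP 2007, (13.7) (the `ψ₁`
  explicit formula). [MontgomeryVaughan2007]
* K. Broughan, *Equivalents of the Riemann Hypothesis* vol. 3, CUP 2023, ch. 2 (secondary locator,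
  not held). [Broughan2023Further]
-/

noncomputable section

open Complex Filter Set MeasureTheory Topology
open scoped Real Chebyshev

namespace Literature.NumberTheory.LFunctions

namespace Nicolas2022

open NicolasJExplicit NicolasJ

/-! ### The terms of `S` and their absolute convergence (RH-free) -/

/-- The `ρ`-th term `m(ρ) t^ρ/ρ²` of `S(t)` ((1.3)). [cite: Nicolas2022HC, (1.3)] -/
def sTerm (ρ : Zeros) (t : ℝ) : ℂ :=
  (riemannZetaZeroOrder (ρ : ℂ) : ℂ) * (((t : ℂ) ^ ((ρ : ℂ))) / (ρ : ℂ) ^ 2)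

/-- `S(t) = ∑_ρ sTerm ρ t` (the two copies of the set of non-trivial zeros in the tree are
definitionally equal). [cite: Nicolas2022HC, (1.3)] -/
theorem S_eq_tsum_sTerm (t : ℝ) : S t = ∑' ρ : Zeros, sTerm ρ t := rfl

/-- `‖m(ρ) t^ρ/ρ²‖ = m(ρ) t^{Re ρ}/‖ρ‖²` (`t > 0`). [cite: Nicolas2022HC, (1.3)–(1.4)] -/
theorem norm_sTerm_eq (ρ : Zeros) {t : ℝ} (ht : 0 < t) :
    ‖sTerm ρ t‖ = (riemannZetaZeroOrder (ρ : ℂ) : ℝ) * (t ^ ((ρ : ℂ)).re / ‖(ρ : ℂ)‖ ^ 2) := by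
  rw [sTerm, norm_mul, Complex.norm_intCast, abs_of_nonneg (zeroOrder_nonneg' ρ), norm_div,
    Complex.norm_cpow_eq_rpow_re_of_pos ht, norm_pow]

/-- `‖m(ρ) t^ρ/ρ²‖ ≤ t · m(ρ)/‖ρ‖²` for `t ≥ 1` (`Re ρ < 1`). [cite: Nicolas2022HC, (1.3) (absolute convergence of S)] -/
theorem norm_sTerm_le (ρ : Zeros) {t : ℝ} (ht : 1 ≤ t) :
    ‖sTerm ρ t‖ ≤ t * ((riemannZetaZeroOrder (ρ : ℂ) : ℝ) / ‖(ρ : ℂ)‖ ^ 2) := by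
  have ht0 : 0 < t := by linarith
  rw [norm_sTerm_eq ρ ht0]
  have hm := zeroOrder_nonneg' ρ
  have hpow : t ^ ((ρ : ℂ)).re ≤ t := by
    calc t ^ ((ρ : ℂ)).re ≤ t ^ (1 : ℝ) :=
          Real.rpow_le_rpow_of_exponent_le ht (re_lt_one ρ.2).le
      _ = t := Real.rpow_one t
  have h0 : 0 ≤ ‖(ρ : ℂ)‖ ^ 2 := sq_nonneg _
  calc (riemannZetaZeroOrder (ρ : ℂ) : ℝ) * (t ^ ((ρ : ℂ)).re / ‖(ρ : ℂ)‖ ^ 2)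
      ≤ (riemannZetaZeroOrder (ρ : ℂ) : ℝ) * (t / ‖(ρ : ℂ)‖ ^ 2) :=
        mul_le_mul_of_nonneg_left (div_le_div_of_nonneg_right hpow h0) hm
    _ = t * ((riemannZetaZeroOrder (ρ : ℂ) : ℝ) / ‖(ρ : ℂ)‖ ^ 2) := by ring

/-- **`∑_ρ m(ρ)/|ρ|² < ∞`, unconditionally** (from the tree's `∑ m(ρ)/(1+γ²) < ∞` and the gap
`|γ| ≥ 2δ > 0`). [cite: Nicolas2022HC, Def. 2.4 (τ₂ = ∑ 1/ρ² converges)] -/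
theorem summable_zeroOrder_div_norm_sq :
    Summable fun ρ : Zeros ↦ (riemannZetaZeroOrder (ρ : ℂ) : ℝ) / ‖(ρ : ℂ)‖ ^ 2 := by
  obtain ⟨δ, hδ, -, hgap⟩ := ZetaZeroSum.exists_gap_im
  have hS := ZetaZeroSum.summable_zeroOrder_div_one_add_sq
  refine (hS.mul_left (1 + 1 / (4 * δ ^ 2))).of_nonneg_of_le
    (fun ρ ↦ div_nonneg (zeroOrder_nonneg' ρ) (sq_nonneg _)) fun ρ ↦ ?_
  have hm := zeroOrder_nonneg' ρ
  have hγ : 2 * δ ≤ |(ρ : ℂ).im| := hgap _ ρ.2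
  have hγ2 : 4 * δ ^ 2 ≤ (ρ : ℂ).im ^ 2 := by
    have h := pow_le_pow_left₀ (by linarith) hγ 2
    rw [sq_abs] at h; nlinarith
  have hnorm : (ρ : ℂ).im ^ 2 ≤ ‖(ρ : ℂ)‖ ^ 2 := by
    rw [Complex.sq_norm, Complex.normSq_apply]; nlinarith
  have hpos : 0 < (ρ : ℂ).im ^ 2 := lt_of_lt_of_le (by positivity) hγ2
  have hnpos : 0 < ‖(ρ : ℂ)‖ ^ 2 := lt_of_lt_of_le hpos hnorm
  -- `1/‖ρ‖² ≤ 1/γ² ≤ (1 + 1/(4δ²))/(1 + γ²)` since `1 + γ² ≤ γ² + γ²/(4δ²)`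
  have hkey : 1 / ‖(ρ : ℂ)‖ ^ 2 ≤ (1 + 1 / (4 * δ ^ 2)) / (1 + (ρ : ℂ).im ^ 2) := by
    have h1 : 1 / ‖(ρ : ℂ)‖ ^ 2 ≤ 1 / (ρ : ℂ).im ^ 2 := one_div_le_one_div_of_le hpos hnorm
    refine h1.trans ?_
    rw [div_le_div_iff₀ hpos (by positivity)]
    have h2 : (1 : ℝ) ≤ (ρ : ℂ).im ^ 2 / (4 * δ ^ 2) := by
      rw [le_div_iff₀ (by positivity)]; linarith
    calc 1 * (1 + (ρ : ℂ).im ^ 2) = 1 + (ρ : ℂ).im ^ 2 := one_mul _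
      _ ≤ (ρ : ℂ).im ^ 2 / (4 * δ ^ 2) + (ρ : ℂ).im ^ 2 := by linarith
      _ = (1 + 1 / (4 * δ ^ 2)) * (ρ : ℂ).im ^ 2 := by ring
  calc (riemannZetaZeroOrder (ρ : ℂ) : ℝ) / ‖(ρ : ℂ)‖ ^ 2
      = (riemannZetaZeroOrder (ρ : ℂ) : ℝ) * (1 / ‖(ρ : ℂ)‖ ^ 2) := by ring
    _ ≤ (riemannZetaZeroOrder (ρ : ℂ) : ℝ) * ((1 + 1 / (4 * δ ^ 2)) / (1 + (ρ : ℂ).im ^ 2)) :=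
        mul_le_mul_of_nonneg_left hkey hm
    _ = (1 + 1 / (4 * δ ^ 2)) * ((riemannZetaZeroOrder (ρ : ℂ) : ℝ) / (1 + (ρ : ℂ).im ^ 2)) := by ring

/-- **Absolute convergence of `S(t)`** for `t ≥ 1` (RH-free). [cite: Nicolas2022HC, (1.3)] -/
theorem summable_norm_sTerm {t : ℝ} (ht : 1 ≤ t) : Summable fun ρ : Zeros ↦ ‖sTerm ρ t‖ :=
  (summable_zeroOrder_div_norm_sq.mul_left t).of_nonneg_of_le (fun _ ↦ norm_nonneg _)
    fun ρ ↦ norm_sTerm_le ρ ht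

/-- `S(t)` is the sum of its series (`t ≥ 1`). [cite: Nicolas2022HC, (1.3)] -/
theorem hasSum_sTerm {t : ℝ} (ht : 1 ≤ t) : HasSum (fun ρ : Zeros ↦ sTerm ρ t) (S t) := by
  rw [S_eq_tsum_sTerm]; exact (summable_norm_sTerm ht).of_norm.hasSum

/-! ### The constant `∑_ρ m(ρ)/(ρ²(ρ+1))` -/

/-- The `ρ`-th term `m(ρ)/(ρ²(ρ+1))` of the constant in `S = Z/x + ∫ Z/t² + const`. [folklore] -/
def cTerm (ρ : Zeros) : ℂ := (riemannZetaZeroOrder (ρ : ℂ) : ℂ) / ((ρ : ℂ) ^ 2 * ((ρ : ℂ) + 1))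

/-- `‖m(ρ)/(ρ²(ρ+1))‖ ≤ m(ρ)/‖ρ‖²` (`|ρ + 1| ≥ 1`). [folklore] -/
private theorem norm_cTerm_le (ρ : Zeros) :
    ‖cTerm ρ‖ ≤ (riemannZetaZeroOrder (ρ : ℂ) : ℝ) / ‖(ρ : ℂ)‖ ^ 2 := by
  have hm := zeroOrder_nonneg' ρ
  have h1 : 1 ≤ ‖(ρ : ℂ) + 1‖ := by
    have hre : 1 ≤ ((ρ : ℂ) + 1).re := by
      rw [add_re, one_re]; linarith [re_pos ρ.2]
    exact hre.trans (Complex.re_le_norm _)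
  have hρ0 : 0 < ‖(ρ : ℂ)‖ := norm_pos_iff.2 (ne_zero ρ.2)
  rw [cTerm, norm_div, Complex.norm_intCast, abs_of_nonneg hm, norm_mul, norm_pow]
  refine div_le_div_of_nonneg_left hm (by positivity) ?_
  calc ‖(ρ : ℂ)‖ ^ 2 = ‖(ρ : ℂ)‖ ^ 2 * 1 := (mul_one _).symm
    _ ≤ ‖(ρ : ℂ)‖ ^ 2 * ‖(ρ : ℂ) + 1‖ := mul_le_mul_of_nonneg_left h1 (sq_nonneg _)

/-- `∑_ρ ‖m(ρ)/(ρ²(ρ+1))‖ < ∞` (the constant of our form of (2.19) converges absolutely).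
[cite: Nicolas2022HC, Lemma 2.5 (2.19) (the constant term)] -/
theorem summable_norm_cTerm : Summable fun ρ : Zeros ↦ ‖cTerm ρ‖ :=
  summable_zeroOrder_div_norm_sq.of_nonneg_of_le (fun _ ↦ norm_nonneg _) norm_cTerm_le

/-- The absolute constant `c_Z = ∑_ρ m(ρ)/(ρ²(ρ+1))`. [folklore] -/
def sConst : ℂ := ∑' ρ : Zeros, cTerm ρ

/-! ### The per-zero identity -/

/-- For real `t > 0`: `t^{ρ+1}/t² = t^{ρ−1}` (complex powers of a positive real). [folklore] -/
private theorem cpow_add_one_div_sq {t : ℝ} (ht : 0 < t) (ρ : ℂ) :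
    (t : ℂ) ^ (ρ + 1) / (t : ℂ) ^ 2 = (t : ℂ) ^ (ρ - 1) := by
  have ht0 : (t : ℂ) ≠ 0 := Complex.ofReal_ne_zero.2 ht.ne'
  have h : (t : ℂ) ^ (ρ + 1) = (t : ℂ) ^ (ρ - 1) * (t : ℂ) ^ 2 := by
    rw [show ρ + 1 = (ρ - 1) + 2 by ring, Complex.cpow_add _ _ ht0]
    norm_cast
  rw [h, mul_div_assoc, div_self (pow_ne_zero 2 ht0), mul_one]

/-- `zeroTerm ρ t/t² = m(ρ) t^{ρ−1}/(ρ(ρ+1))` for `t > 0`. [folklore] -/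
private theorem zeroTerm_div_sq {t : ℝ} (ht : 0 < t) (ρ : Zeros) :
    zeroTerm ρ t / (t : ℂ) ^ 2 =
      (riemannZetaZeroOrder (ρ : ℂ) : ℂ) * ((t : ℂ) ^ ((ρ : ℂ) - 1) / ((ρ : ℂ) * (ρ + 1))) := by
  rw [zeroTerm, mul_div_assoc, div_div, mul_comm ((ρ : ℂ) * (ρ + 1)), ← div_div,
    cpow_add_one_div_sq ht]

/-- `∫₁^x t^{ρ−1} dt = (x^ρ − 1)/ρ` (`x ≥ 1`, `ρ ≠ 0`). [folklore] -/
private theorem integral_cpow_sub_one {x : ℝ} (hx : 1 ≤ x) {ρ : ℂ} (hρ : ρ ≠ 0) :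
    ∫ t in (1 : ℝ)..x, (t : ℂ) ^ (ρ - 1) = ((x : ℂ) ^ ρ - 1) / ρ := by
  have h0 : (0 : ℝ) ∉ Set.uIcc (1 : ℝ) x := by
    rw [Set.uIcc_of_le hx]; intro h; exact absurd h.1 (by norm_num)
  have hr : ρ - 1 ≠ -1 := by
    intro h; apply hρ; linear_combination h
  rw [integral_cpow (Or.inr ⟨hr, h0⟩)]
  simp only [sub_add_cancel, Complex.ofReal_one, Complex.one_cpow]

/-- **The per-zero identity**: for `x ≥ 1`,
`m x^ρ/ρ² = zeroTerm ρ x/x + ∫₁^x zeroTerm ρ t/t² dt + m/(ρ²(ρ+1))`.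
[cite: Nicolas2022HC, Lemma 2.5 (proof, per zero)] -/
theorem sTerm_eq (ρ : Zeros) {x : ℝ} (hx : 1 ≤ x) :
    sTerm ρ x = zeroTerm ρ x / x + (∫ t in (1 : ℝ)..x, zeroTerm ρ t / (t : ℂ) ^ 2) + cTerm ρ := by
  have hx0 : 0 < x := by linarith
  have hρ0 : (ρ : ℂ) ≠ 0 := ne_zero ρ.2
  have hρ1 : (ρ : ℂ) + 1 ≠ 0 := add_one_ne_zero ρ.2
  have hxC : (x : ℂ) ≠ 0 := Complex.ofReal_ne_zero.2 hx0.ne'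
  -- the integral
  have hint : ∫ t in (1 : ℝ)..x, zeroTerm ρ t / (t : ℂ) ^ 2 =
      (riemannZetaZeroOrder (ρ : ℂ) : ℂ) * ((((x : ℂ) ^ (ρ : ℂ) - 1) / (ρ : ℂ)) / ((ρ : ℂ) * (ρ + 1))) := by
    have hcongr : ∫ t in (1 : ℝ)..x, zeroTerm ρ t / (t : ℂ) ^ 2 =
        ∫ t in (1 : ℝ)..x, (riemannZetaZeroOrder (ρ : ℂ) : ℂ) *
          ((t : ℂ) ^ ((ρ : ℂ) - 1) * ((ρ : ℂ) * (ρ + 1))⁻¹) := by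
      refine intervalIntegral.integral_congr fun t ht ↦ ?_
      rw [Set.uIcc_of_le hx] at ht
      rw [zeroTerm_div_sq (by linarith [ht.1]) ρ, div_eq_mul_inv]
    rw [hcongr, intervalIntegral.integral_const_mul, intervalIntegral.integral_mul_const,
      integral_cpow_sub_one hx hρ0, ← div_eq_mul_inv]
  -- `x^{ρ+1}/x = x^ρ`
  have hpow : (x : ℂ) ^ ((ρ : ℂ) + 1) = (x : ℂ) ^ (ρ : ℂ) * x := by
    rw [Complex.cpow_add _ _ hxC, Complex.cpow_one]
  rw [hint, sTerm, cTerm, zeroTerm, hpow]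
  field_simp
  ring

/-! ### Summing over the zeros: `S = Z/x + ∫₁^x Z/t² + c_Z` -/

/-- Each `t ↦ zeroTerm ρ t/t²` is continuous on `[1, X]`. [folklore] -/
private theorem continuousOn_zeroTerm_div_sq (ρ : Zeros) (X : ℝ) :
    ContinuousOn (fun t : ℝ ↦ zeroTerm ρ t / (t : ℂ) ^ 2) (Icc 1 X) := by
  have hc : Continuous fun t : ℝ ↦ (t : ℂ) ^ ((ρ : ℂ) + 1) :=
    continuous_ofReal_cpow_const (by rw [add_re, one_re]; linarith [re_pos ρ.2])
  have hz : Continuous fun t : ℝ ↦ zeroTerm ρ t := continuous_const.mul (hc.div_const _)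
  refine hz.continuousOn.div ((Complex.continuous_ofReal.pow 2).continuousOn) fun t ht ↦ ?_
  exact pow_ne_zero 2 (Complex.ofReal_ne_zero.2 (by linarith [ht.1]))

/-- Dominated convergence: **`∑_ρ ∫₁^x zeroTerm ρ t/t² dt = ∫₁^x Z(t)/t² dt`** (`x ≥ 1`; on `[1, x]`
every term is bounded by `x² ‖zeroTerm ρ 1‖`, a summable sequence). [cite: Nicolas2022HC, Lemma 2.3 (termwise integration)] -/
theorem hasSum_integral_zeroTerm_div_sq {x : ℝ} (hx : 1 ≤ x) :
    HasSum (fun ρ : Zeros ↦ ∫ t in (1 : ℝ)..x, zeroTerm ρ t / (t : ℂ) ^ 2)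
      (∫ t in (1 : ℝ)..x, Zsum t / (t : ℂ) ^ 2) := by
  have hsum1 : Summable fun ρ : Zeros ↦ ‖zeroTerm ρ 1‖ := summable_norm_psiOne_zeroTerm le_rfl
  have hΙ : Set.uIoc (1 : ℝ) x = Ioc 1 x := Set.uIoc_of_le hx
  refine intervalIntegral.hasSum_integral_of_dominated_convergence
    (fun ρ _ ↦ x ^ 2 * ‖zeroTerm ρ 1‖) (fun ρ ↦ ?_) (fun ρ ↦ ?_) ?_ ?_ ?_
  · rw [hΙ]
    exact ((continuousOn_zeroTerm_div_sq ρ x).mono Ioc_subset_Icc_self).aestronglyMeasurable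
      measurableSet_Ioc
  · refine ae_of_all _ fun t ht ↦ ?_
    rw [hΙ] at ht
    have ht1 : 1 ≤ t := ht.1.le
    have ht0 : 0 < t := by linarith
    have hnt : ‖(t : ℂ) ^ 2‖ = t ^ 2 := by
      rw [norm_pow, Complex.norm_real, Real.norm_eq_abs, abs_of_pos ht0]
    rw [norm_div, hnt]
    calc ‖zeroTerm ρ t‖ / t ^ 2 ≤ ‖zeroTerm ρ t‖ / 1 :=
          div_le_div_of_nonneg_left (norm_nonneg _) one_pos (by nlinarith)
      _ = ‖zeroTerm ρ t‖ := div_one _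
      _ ≤ x ^ 2 * ‖zeroTerm ρ 1‖ := norm_zeroTerm_le_sq_mul ρ ⟨ht1, ht.2⟩
  · exact ae_of_all _ fun t _ ↦ hsum1.mul_left _
  · exact intervalIntegrable_const
  · refine ae_of_all _ fun t ht ↦ ?_
    rw [hΙ] at ht
    have h := (summable_zeroTerm ht.1.le).hasSum
    exact h.div_const _

/-- **`S(x) = Z(x)/x + ∫₁^x Z(t)/t² dt + c_Z`** for `x ≥ 1` (RH-free).
[cite: Nicolas2022HC, Lemma 2.5 (proof)] -/
theorem S_eq_Zsum {x : ℝ} (hx : 1 ≤ x) :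
    S x = Zsum x / x + (∫ t in (1 : ℝ)..x, Zsum t / (t : ℂ) ^ 2) + sConst := by
  have h1 : HasSum (fun ρ : Zeros ↦ zeroTerm ρ x / x) (Zsum x / x) :=
    (summable_zeroTerm hx).hasSum.div_const _
  have h2 := hasSum_integral_zeroTerm_div_sq hx
  have h3 : HasSum (fun ρ : Zeros ↦ cTerm ρ) sConst := summable_norm_cTerm.of_norm.hasSum
  have h := (h1.add h2).add h3
  have heq : (fun ρ : Zeros ↦ zeroTerm ρ x / x + (∫ t in (1 : ℝ)..x, zeroTerm ρ t / (t : ℂ) ^ 2) + cTerm ρ) =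
      fun ρ ↦ sTerm ρ x := funext fun ρ ↦ (sTerm_eq ρ hx).symm
  rw [heq] at h
  exact (hasSum_sTerm hx).unique h

/-! ### From `Z` to `ψ`: Lemma 2.5 -/

/-- Nicolas's `∫₁^x (t − ψ(t))/t dt = ∫₁^x (1 − ψ(t)/t) dt`. [cite: Nicolas2022HC, Lemma 2.5 (2.19)] -/
def primeIntegral (x : ℝ) : ℝ := ∫ t in (1 : ℝ)..x, (1 - ψ t / t)

/-- The bounded error `E₁(x) = Re E(x)/x + ∫₁^x Re E(t)/t² dt` of our form of (2.19).
[cite: Nicolas2022HC, Lemma 2.5 (2.19)] -/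
def sErr (x : ℝ) : ℝ :=
  (psiOneRemainder x).re / x + ∫ t in (1 : ℝ)..x, (psiOneRemainder t).re / t ^ 2

/-- The absolute constant `c₀ = 1/2 − log 2π + Re c_Z` of our form of (2.19). [cite: Nicolas2022HC, Lemma 2.5 (2.19)] -/
def sConstRe : ℝ := 1 / 2 - Real.log (2 * π) + sConst.re

/-- `ψ/t` is interval-integrable on `[a, b] ⊆ (0, ∞)` (so `∫₁^x ψ(t)/t dt` of (2.19) exists).
[cite: Nicolas2022HC, Lemma 2.5 (2.19)] -/
theorem intervalIntegrable_psi_div {a b : ℝ} (ha : 0 < a) (hab : a ≤ b) :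
    IntervalIntegrable (fun t : ℝ ↦ ψ t / t) volume a b := by
  have hg : ContinuousOn (fun t : ℝ ↦ t⁻¹) (Set.uIcc a b) := by
    rw [Set.uIcc_of_le hab]
    exact continuousOn_inv₀.mono fun t ht ↦ by
      simp only [mem_compl_iff, mem_singleton_iff]; linarith [ht.1]
  have h := (intervalIntegrable_psi a b).mul_continuousOn hg
  have heq : (fun t : ℝ ↦ ψ t / t) = fun t ↦ ψ t * t⁻¹ := by
    funext t; rw [div_eq_mul_inv]
  rw [heq]; exact h

/-- `1 − ψ/t` is interval-integrable on `[a, b] ⊆ (0, ∞)` (the integrand of (2.19)).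
[cite: Nicolas2022HC, Lemma 2.5 (2.19)] -/
theorem intervalIntegrable_one_sub_psi_div {a b : ℝ} (ha : 0 < a) (hab : a ≤ b) :
    IntervalIntegrable (fun t : ℝ ↦ 1 - ψ t / t) volume a b :=
  intervalIntegrable_const.sub (intervalIntegrable_psi_div ha hab)

/-- `I(y) − I(x) = ∫_x^y (1 − ψ(t)/t) dt` for `1 ≤ x ≤ y` (first line of the proof of Lemma 2.7).
[cite: Nicolas2022HC, Lemma 2.7 (proof)] -/
theorem primeIntegral_sub {x y : ℝ} (hx : 1 ≤ x) (hxy : x ≤ y) :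
    primeIntegral y - primeIntegral x = ∫ t in x..y, (1 - ψ t / t) := by
  rw [primeIntegral, primeIntegral]
  exact intervalIntegral.integral_interval_sub_left
    (intervalIntegrable_one_sub_psi_div one_pos (hx.trans hxy))
    (intervalIntegrable_one_sub_psi_div one_pos hx)

/-- **RH-FREE Lipschitz bound**: if `|1 − ψ(t)/t| ≤ M` on `[x, y]` then `|I(y) − I(x)| ≤ M (y − x)`
(the input of Lemma 2.7). [cite: Nicolas2022HC, Lemma 2.7 (proof)] -/
theorem abs_primeIntegral_sub_le {x y M : ℝ} (hx : 1 ≤ x) (hxy : x ≤ y)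
    (hM : ∀ t ∈ Icc x y, |1 - ψ t / t| ≤ M) :
    |primeIntegral y - primeIntegral x| ≤ M * (y - x) := by
  rw [primeIntegral_sub hx hxy]
  have h := intervalIntegral.norm_integral_le_of_norm_le_const (a := x) (b := y) (C := M)
    (f := fun t : ℝ ↦ 1 - ψ t / t) fun t ht ↦ by
      rw [Set.uIoc_of_le hxy] at ht
      rw [Real.norm_eq_abs]; exact hM t ⟨ht.1.le, ht.2⟩
  rw [Real.norm_eq_abs, abs_of_nonneg (by linarith : 0 ≤ y - x)] at h
  exact h

/-- `ψ₁(1) = 0`. [folklore] -/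
private theorem psiOne_one : psiOne 1 = 0 := by
  rw [psiOne, Nat.floor_one]
  simp

/-- FTC for `ψ₁(t)/t` on `[1, x]`: **`∫₁^x ψ(t)/t dt = ψ₁(x)/x + ∫₁^x ψ₁(t)/t² dt`** (`x ≥ 1`).
[cite: Nicolas2022HC, Lemma 2.5 (proof)] -/
theorem integral_psi_div_eq {x : ℝ} (hx : 1 ≤ x) :
    ∫ t in (1 : ℝ)..x, ψ t / t = psiOne x / x + ∫ t in (1 : ℝ)..x, psiOne t / t ^ 2 := by
  -- right derivative of `ψ₁(t)/t`
  have hderiv : ∀ t ∈ Ioo (1 : ℝ) x,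
      HasDerivWithinAt (fun u : ℝ ↦ psiOne u / u) (ψ t / t - psiOne t / t ^ 2) (Ioi t) t := by
    intro t ht
    have ht0 : t ≠ 0 := by linarith [ht.1]
    have h1 := hasDerivWithinAt_psiOne t
    have h2 : HasDerivWithinAt (fun u : ℝ ↦ u) 1 (Ioi t) t := hasDerivWithinAt_id t _
    have h := h1.div h2 ht0
    refine h.congr_deriv ?_
    field_simp
  have hcont : ContinuousOn (fun u : ℝ ↦ psiOne u / u) (Icc 1 x) :=
    continuous_psiOne.continuousOn.div continuousOn_id fun t ht ↦ by linarith [ht.1]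
  have hi1 : IntervalIntegrable (fun t : ℝ ↦ ψ t / t) volume 1 x := intervalIntegrable_psi_div one_pos hx
  have hi2 : IntervalIntegrable (fun t : ℝ ↦ psiOne t / t ^ 2) volume 1 x := by
    refine (continuous_psiOne.continuousOn.div (continuousOn_pow 2) fun t ht ↦ ?_).intervalIntegrable_of_Icc hx
    exact pow_ne_zero 2 (by linarith [ht.1])
  have hftc := intervalIntegral.integral_eq_sub_of_hasDeriv_right_of_le hx hcont hderiv (hi1.sub hi2)
  rw [intervalIntegral.integral_sub hi1 hi2, psiOne_one, zero_div, sub_zero] at hftc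
  linarith

/-- `Re Z(t) = −(ψ₁(t) − t²/2) − t log 2π + Re E(t)` for `t ≥ 1` (real part of the `ψ₁` explicit
formula). [cite: MontgomeryVaughan2007, (13.7)] -/
theorem re_Zsum_eq {t : ℝ} (ht : 1 ≤ t) :
    (Zsum t).re = -Rone t - t * Real.log (2 * π) + (psiOneRemainder t).re := by
  have h := Rone_eq_explicit ht
  rw [log_two_pi] at h
  have h' : Zsum t = ((-Rone t - t * Real.log (2 * π) : ℝ) : ℂ) + psiOneRemainder t := by
    push_cast
    linear_combination h
  rw [h', Complex.add_re, Complex.ofReal_re]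

/-- `Re E` is continuous on `[1, ∞)`. [folklore] -/
private theorem continuousOn_re_psiOneRemainder :
    ContinuousOn (fun t : ℝ ↦ (psiOneRemainder t).re) (Ici 1) :=
  Complex.continuous_re.comp_continuousOn continuousOn_psiOneRemainder

/-- `Re E(t)/t²` is interval-integrable on `[1, x]`. [folklore] -/
private theorem intervalIntegrable_re_psiOneRemainder_div_sq {x : ℝ} (hx : 1 ≤ x) :
    IntervalIntegrable (fun t : ℝ ↦ (psiOneRemainder t).re / t ^ 2) volume 1 x := by
  refine ((continuousOn_re_psiOneRemainder.mono fun t ht ↦ (ht.1 : (1 : ℝ) ≤ t)).div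
    (continuousOn_pow 2) fun t ht ↦ ?_).intervalIntegrable_of_Icc hx
  exact pow_ne_zero 2 (by linarith [ht.1])

/-- `Re Z` is continuous on `[1, ∞)`. [folklore] -/
private theorem continuousOn_re_Zsum : ContinuousOn (fun t : ℝ ↦ (Zsum t).re) (Ici 1) :=
  Complex.continuous_re.comp_continuousOn continuousOn_Zsum

/-- `Re (∫₁^x Z/t²) = ∫₁^x Re Z(t)/t² dt` (`x ≥ 1`). [folklore] -/
private theorem re_integral_Zsum_div_sq {x : ℝ} (hx : 1 ≤ x) :
    (∫ t in (1 : ℝ)..x, Zsum t / (t : ℂ) ^ 2).re = ∫ t in (1 : ℝ)..x, (Zsum t).re / t ^ 2 := by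
  have hint : IntervalIntegrable (fun t : ℝ ↦ Zsum t / (t : ℂ) ^ 2) volume 1 x := by
    refine (continuousOn_Zsum.mono (fun t ht ↦ (ht.1 : (1 : ℝ) ≤ t)) |>.div
      ((Complex.continuous_ofReal.pow 2).continuousOn) fun t ht ↦ ?_).intervalIntegrable_of_Icc hx
    exact pow_ne_zero 2 (Complex.ofReal_ne_zero.2 (by linarith [ht.1]))
  have h := (Complex.reCLM.intervalIntegral_comp_comm hint)
  simp only [Complex.reCLM_apply] at h
  rw [← h]
  refine intervalIntegral.integral_congr fun t _ ↦ ?_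
  show (Zsum t / (t : ℂ) ^ 2).re = (Zsum t).re / t ^ 2
  rw [show ((t : ℂ) ^ 2) = ((t ^ 2 : ℝ) : ℂ) by push_cast; ring, Complex.div_ofReal_re]

/-- **Nicolas 2022, Lemma 2.5 (2.19) (real part, RH-FREE)**: for `x ≥ 1`,
`Re S(x) = ∫₁^x (1 − ψ(t)/t) dt − log(2π) log x + c₀ + E₁(x)`.
[cite: Nicolas2022HC, Lemma 2.5 (2.19)] -/
theorem re_S_eq {x : ℝ} (hx : 1 ≤ x) :
    (S x).re = primeIntegral x - Real.log (2 * π) * Real.log x + sConstRe + sErr x := by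
  have hx0 : 0 < x := by linarith
  -- real part of `S = Z/x + ∫ Z/t² + c_Z`
  have h0 : (S x).re = (Zsum x).re / x + (∫ t in (1 : ℝ)..x, (Zsum t).re / t ^ 2) + sConst.re := by
    rw [S_eq_Zsum hx, Complex.add_re, Complex.add_re, re_integral_Zsum_div_sq hx, Complex.div_ofReal_re]
  -- the pieces of `∫₁^x Re Z/t²`
  have hiR : IntervalIntegrable (fun t : ℝ ↦ Rone t / t ^ 2) volume 1 x := by
    refine ((continuous_psiOne.sub ((continuous_pow 2).div_const 2)).continuousOn.div
      (continuousOn_pow 2) fun t ht ↦ ?_).intervalIntegrable_of_Icc hx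
    exact pow_ne_zero 2 (by linarith [ht.1])
  have hiL : IntervalIntegrable (fun t : ℝ ↦ t * Real.log (2 * π) / t ^ 2) volume 1 x := by
    refine ((continuous_id.mul continuous_const).continuousOn.div (continuousOn_pow 2)
      fun t ht ↦ ?_).intervalIntegrable_of_Icc hx
    exact pow_ne_zero 2 (by linarith [ht.1])
  have hiE := intervalIntegrable_re_psiOneRemainder_div_sq hx
  have h1 : ∫ t in (1 : ℝ)..x, (Zsum t).re / t ^ 2 =
      -(∫ t in (1 : ℝ)..x, Rone t / t ^ 2) - (∫ t in (1 : ℝ)..x, t * Real.log (2 * π) / t ^ 2) +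
        ∫ t in (1 : ℝ)..x, (psiOneRemainder t).re / t ^ 2 := by
    have hc : ∫ t in (1 : ℝ)..x, (Zsum t).re / t ^ 2 =
        ∫ t in (1 : ℝ)..x, (((psiOneRemainder t).re / t ^ 2 - Rone t / t ^ 2) -
          t * Real.log (2 * π) / t ^ 2) := by
      refine intervalIntegral.integral_congr fun t ht ↦ ?_
      rw [Set.uIcc_of_le hx] at ht
      show (Zsum t).re / t ^ 2 = _
      rw [re_Zsum_eq ht.1]
      ring
    rw [hc, intervalIntegral.integral_sub (hiE.sub hiR) hiL, intervalIntegral.integral_sub hiE hiR]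
    ring
  -- `∫₁^x t log(2π)/t² = log(2π) log x`
  have h2 : ∫ t in (1 : ℝ)..x, t * Real.log (2 * π) / t ^ 2 = Real.log (2 * π) * Real.log x := by
    have hc : ∫ t in (1 : ℝ)..x, t * Real.log (2 * π) / t ^ 2 =
        ∫ t in (1 : ℝ)..x, Real.log (2 * π) * t⁻¹ := by
      refine intervalIntegral.integral_congr fun t ht ↦ ?_
      rw [Set.uIcc_of_le hx] at ht
      have ht0 : t ≠ 0 := by linarith [ht.1]
      show t * Real.log (2 * π) / t ^ 2 = Real.log (2 * π) * t⁻¹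
      field_simp
    rw [hc, intervalIntegral.integral_const_mul, integral_inv (by
      rw [Set.uIcc_of_le hx]; intro h; exact absurd h.1 (by norm_num)), div_one]
  -- `∫₁^x Rone/t² = ∫₁^x ψ₁/t² − (x − 1)/2`
  have hiP : IntervalIntegrable (fun t : ℝ ↦ psiOne t / t ^ 2) volume 1 x := by
    refine (continuous_psiOne.continuousOn.div (continuousOn_pow 2) fun t ht ↦ ?_).intervalIntegrable_of_Icc hx
    exact pow_ne_zero 2 (by linarith [ht.1])
  have h3 : ∫ t in (1 : ℝ)..x, Rone t / t ^ 2 = (∫ t in (1 : ℝ)..x, psiOne t / t ^ 2) - (x - 1) / 2 := by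
    have hc : ∫ t in (1 : ℝ)..x, Rone t / t ^ 2 = ∫ t in (1 : ℝ)..x, (psiOne t / t ^ 2 - 1 / 2) := by
      refine intervalIntegral.integral_congr fun t ht ↦ ?_
      rw [Set.uIcc_of_le hx] at ht
      have ht0 : t ≠ 0 := by linarith [ht.1]
      show Rone t / t ^ 2 = psiOne t / t ^ 2 - 1 / 2
      rw [Rone]
      field_simp
    rw [hc, intervalIntegral.integral_sub hiP intervalIntegrable_const, intervalIntegral.integral_const,
      smul_eq_mul]
    ring
  -- `ψ₁(x)/x + ∫₁^x ψ₁/t² = ∫₁^x ψ/t`, and `I(x) = (x − 1) − ∫₁^x ψ/t`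
  have h4 := integral_psi_div_eq hx
  have h5 : primeIntegral x = (x - 1) - ∫ t in (1 : ℝ)..x, ψ t / t := by
    rw [primeIntegral, intervalIntegral.integral_sub intervalIntegrable_const (intervalIntegrable_psi_div one_pos hx),
      intervalIntegral.integral_const, smul_eq_mul, mul_one]
  -- `Re Z(x)/x`
  have h6 : (Zsum x).re / x = -(psiOne x / x) + x / 2 - Real.log (2 * π) + (psiOneRemainder x).re / x := by
    rw [re_Zsum_eq hx, Rone]
    field_simp
    ring
  rw [h0, h1, h2, h3, h6, sErr, sConstRe, h5]
  linarith [h4]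

/-! ### The error `E₁` is bounded -/

/-- **`|E₁(x)| ≤ K` for `x ≥ 1`** (from `‖E(t)‖ ≤ C√t`: `|Re E(x)|/x ≤ C` and
`∫₁^x C√t/t² dt ≤ 2C`). [cite: MontgomeryVaughan2007, (13.7) (E(x) = O(√x))] -/
theorem exists_abs_sErr_le : ∃ K : ℝ, 0 < K ∧ ∀ x : ℝ, 1 ≤ x → |sErr x| ≤ K := by
  obtain ⟨C, hC0, hC⟩ := exists_norm_psiOneRemainder_le
  refine ⟨3 * C, by positivity, fun x hx ↦ ?_⟩
  have hx0 : 0 < x := by linarith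
  -- first piece
  have h1 : |(psiOneRemainder x).re / x| ≤ C := by
    rw [abs_div, abs_of_pos hx0, div_le_iff₀ hx0]
    calc |(psiOneRemainder x).re| ≤ ‖psiOneRemainder x‖ := Complex.abs_re_le_norm _
      _ ≤ C * Real.sqrt x := hC x hx0
      _ ≤ C * x := by
          refine mul_le_mul_of_nonneg_left ?_ hC0.le
          rw [Real.sqrt_le_left (by linarith)]
          nlinarith
  -- second piece: `|∫₁^x Re E/t²| ≤ ∫₁^x C t^{-3/2} ≤ 2C`
  have h2 : |∫ t in (1 : ℝ)..x, (psiOneRemainder t).re / t ^ 2| ≤ 2 * C := by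
    have hb : ∀ t ∈ Ioc (1 : ℝ) x, ‖(psiOneRemainder t).re / t ^ 2‖ ≤ C * t ^ (-(3 : ℝ) / 2) := by
      intro t ht
      have ht0 : 0 < t := by linarith [ht.1]
      rw [Real.norm_eq_abs, abs_div, abs_of_pos (by positivity : (0 : ℝ) < t ^ 2), div_le_iff₀ (by positivity)]
      calc |(psiOneRemainder t).re| ≤ ‖psiOneRemainder t‖ := Complex.abs_re_le_norm _
        _ ≤ C * Real.sqrt t := hC t ht0
        _ = C * t ^ (-(3 : ℝ) / 2) * t ^ 2 := by
            rw [Real.sqrt_eq_rpow, mul_assoc, show (t ^ 2 : ℝ) = t ^ (2 : ℝ) by norm_cast,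
              ← Real.rpow_add ht0]
            norm_num
    have h0 : (0 : ℝ) ∉ Set.uIcc (1 : ℝ) x := by
      rw [Set.uIcc_of_le hx]; intro h0; exact absurd h0.1 (by norm_num)
    have hgi : IntervalIntegrable (fun t : ℝ ↦ C * t ^ (-(3 : ℝ) / 2)) volume 1 x :=
      (intervalIntegral.intervalIntegrable_rpow (Or.inr h0)).const_mul C
    have h := intervalIntegral.norm_integral_le_of_norm_le hx (ae_of_all _ hb) hgi
    rw [Real.norm_eq_abs] at h
    refine h.trans ?_
    rw [intervalIntegral.integral_const_mul, integral_rpow (Or.inr ⟨by norm_num, h0⟩), Real.one_rpow]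
    have hx' : 0 ≤ x ^ (-(3 : ℝ) / 2 + 1) := Real.rpow_nonneg hx0.le _
    have : C * ((x ^ (-(3 : ℝ) / 2 + 1) - 1) / (-(3 : ℝ) / 2 + 1)) = 2 * C * (1 - x ^ (-(3 : ℝ) / 2 + 1)) := by
      field_simp; ring
    rw [this]
    nlinarith
  calc |sErr x| ≤ |(psiOneRemainder x).re / x| + |∫ t in (1 : ℝ)..x, (psiOneRemainder t).re / t ^ 2| :=
        abs_add_le _ _
    _ ≤ C + 2 * C := add_le_add h1 h2
    _ = 3 * C := by ring

/-! ### Under RH: (1.4), (1.6) and the bound on `I(x)` -/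

/-- Under RH, `‖sTerm ρ t‖ = √t · m(ρ)/‖ρ‖²` (`t > 0`). [cite: Nicolas2022HC, (1.4)] -/
theorem norm_sTerm_of_RH (hRH : RiemannHypothesis) (ρ : Zeros) {t : ℝ} (ht : 0 < t) :
    ‖sTerm ρ t‖ = Real.sqrt t * ((riemannZetaZeroOrder (ρ : ℂ) : ℝ) / ‖(ρ : ℂ)‖ ^ 2) := by
  rw [norm_sTerm_eq ρ ht, re_eq_half_of_RH hRH ρ.2, Real.sqrt_eq_rpow]
  ring

/-- **(1.4): under RH, `|S(t)| ≤ τ√t`** for `t > 0` (`τ = ∑_ρ m(ρ)/|ρ|² = nicolasBeta`).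
[cite: Nicolas2022HC, (1.4)] -/
theorem norm_S_le_of_RH (hRH : RiemannHypothesis) {t : ℝ} (ht : 0 < t) :
    ‖S t‖ ≤ nicolasBeta * Real.sqrt t := by
  have hlam := hasSum_zeroOrder_div_norm_sq_of_RH hRH
  have hns : HasSum (fun ρ : Zeros ↦ ‖sTerm ρ t‖) (Real.sqrt t * nicolasBeta) := by
    have := hlam.mul_left (Real.sqrt t)
    refine this.congr_fun fun ρ ↦ ?_
    exact norm_sTerm_of_RH hRH ρ ht
  rw [S_eq_tsum_sTerm, mul_comm]
  exact (norm_tsum_le_tsum_norm hns.summable).trans hns.tsum_eq.le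

/-- Under RH, `|Re S(t)| ≤ τ√t` (`t > 0`). [cite: Nicolas2022HC, (1.4)] -/
theorem abs_re_S_le_of_RH (hRH : RiemannHypothesis) {t : ℝ} (ht : 0 < t) :
    |(S t).re| ≤ nicolasBeta * Real.sqrt t :=
  (Complex.abs_re_le_norm _).trans (norm_S_le_of_RH hRH ht)

/-- **(1.6), upper half: under RH, `R(t) ≤ (2 + τ)√t/log² t`** (`t > 0`).
[cite: Nicolas2022HC, (1.6)] -/
theorem R_le_of_RH (hRH : RiemannHypothesis) {t : ℝ} (ht : 0 < t) :
    R t ≤ (2 + nicolasBeta) * Real.sqrt t / Real.log t ^ 2 := by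
  have h := abs_re_S_le_of_RH hRH ht
  rw [R]
  refine div_le_div_of_nonneg_right ?_ (sq_nonneg _)
  have := (abs_le.1 h).2
  linarith

/-- **(1.6), lower half: under RH, `(2 − τ)√t/log² t ≤ R(t)`** (`t > 0`).
[cite: Nicolas2022HC, (1.6)] -/
theorem le_R_of_RH (hRH : RiemannHypothesis) {t : ℝ} (ht : 0 < t) :
    (2 - nicolasBeta) * Real.sqrt t / Real.log t ^ 2 ≤ R t := by
  have h := abs_re_S_le_of_RH hRH ht
  rw [R]
  refine div_le_div_of_nonneg_right ?_ (sq_nonneg _)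
  have := (abs_le.1 h).1
  linarith

/-- **Under RH, `|∫₁^x (1 − ψ(t)/t) dt| ≤ τ√x + log(2π) log x + K`** for `x ≥ 1` (Lemma 2.5 with
(1.4)). [cite: Nicolas2022HC, Lemma 2.5 with (1.4)] -/
theorem exists_abs_primeIntegral_le_of_RH (hRH : RiemannHypothesis) :
    ∃ K : ℝ, 0 < K ∧ ∀ x : ℝ, 1 ≤ x →
      |primeIntegral x| ≤ nicolasBeta * Real.sqrt x + Real.log (2 * π) * Real.log x + K := by
  obtain ⟨K, hK0, hK⟩ := exists_abs_sErr_le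
  refine ⟨K + |sConstRe|, by positivity, fun x hx ↦ ?_⟩
  have hx0 : 0 < x := by linarith
  have h := re_S_eq hx
  have hS := abs_re_S_le_of_RH hRH hx0
  have hE := hK x hx
  have hlog : 0 ≤ Real.log (2 * π) * Real.log x :=
    mul_nonneg (Real.log_nonneg (by linarith [Real.pi_gt_three])) (Real.log_nonneg hx)
  have heq : primeIntegral x = (S x).re + Real.log (2 * π) * Real.log x - sConstRe - sErr x := by
    linarith
  have hS1 := (abs_le.1 hS).1
  have hS2 := (abs_le.1 hS).2
  have hE1 := (abs_le.1 hE).1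
  have hE2 := (abs_le.1 hE).2
  have hc1 := neg_abs_le sConstRe
  have hc2 := le_abs_self sConstRe
  rw [heq, abs_le]
  constructor <;> linarith

/-! ### Calculus of `I(x)`: continuity and the right derivative -/

/-- `ψ` is right-continuous: it is constant on `[t, ⌊t⌋₊ + 1)` ("`ψ(t) = ψ(a_i)` for
`a_i ≤ t < a_{i+1}`", as used in the proof of Lemma 2.7). [cite: Nicolas2022HC, Lemma 2.7 (proof)] -/
theorem psi_eventuallyEq_right (t : ℝ) (ht : 0 ≤ t) : ∀ᶠ u in 𝓝[≥] t, ψ u = ψ t := by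
  have hlt : t < ⌊t⌋₊ + 1 := Nat.lt_floor_add_one t
  have hmem : Ico t ((⌊t⌋₊ : ℝ) + 1) ∈ 𝓝[≥] t := by
    rw [← Ici_inter_Iio]
    exact inter_mem_nhdsWithin _ (Iio_mem_nhds hlt)
  filter_upwards [hmem] with u hu
  have hfloor : ⌊u⌋₊ = ⌊t⌋₊ := by
    rw [Nat.floor_eq_iff (ht.trans hu.1)]
    exact ⟨(Nat.floor_le ht).trans hu.1, hu.2⟩
  rw [Chebyshev.psi_eq_psi_coe_floor u, Chebyshev.psi_eq_psi_coe_floor t, hfloor]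

/-- **The right derivative of `I`**: `I'(t⁺) = 1 − ψ(t)/t` for `t ≥ 1`. [cite: Nicolas2022HC, Lemma 2.5 ((2.19) differentiated)] -/
theorem hasDerivWithinAt_primeIntegral {t : ℝ} (ht : 1 ≤ t) :
    HasDerivWithinAt primeIntegral (1 - ψ t / t) (Ioi t) t := by
  have ht0 : 0 < t := by linarith
  have hint : IntervalIntegrable (fun u : ℝ ↦ 1 - ψ u / u) volume 1 t :=
    intervalIntegrable_one_sub_psi_div one_pos ht
  -- continuity from the right of the integrand at `t`
  have hcont : ContinuousWithinAt (fun u : ℝ ↦ 1 - ψ u / u) (Ioi t) t := by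
    have h1 : ContinuousWithinAt (fun u : ℝ ↦ ψ t / u) (Ici t) t :=
      (continuousAt_const.div continuousAt_id ht0.ne').continuousWithinAt
    have h2 : (fun u : ℝ ↦ 1 - ψ u / u) =ᶠ[𝓝[≥] t] fun u ↦ 1 - ψ t / u := by
      filter_upwards [psi_eventuallyEq_right t ht0.le] with u hu
      rw [hu]
    exact ((continuousWithinAt_const.sub h1).congr_of_eventuallyEq h2 (by simp)).mono Ioi_subset_Ici_self
  have hmeas : StronglyMeasurableAtFilter (fun u : ℝ ↦ 1 - ψ u / u) (𝓝[>] t) volume := by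
    refine ⟨Ioo (t / 2) (t + 1), ?_, ?_⟩
    · exact mem_nhdsWithin_of_mem_nhds (Ioo_mem_nhds (by linarith) (by linarith))
    · have hi : IntervalIntegrable (fun u : ℝ ↦ 1 - ψ u / u) volume (t / 2) (t + 1) :=
        intervalIntegrable_one_sub_psi_div (by linarith) (by linarith)
      have := (intervalIntegrable_iff_integrableOn_Ioo_of_le (by linarith)).1 hi
      exact this.aestronglyMeasurable
  have h := intervalIntegral.integral_hasDerivWithinAt_right (s := Ici t) (t := Ioi t) hint hmeas hcont
  -- `Ici`-derivative gives the `Ioi`-derivative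
  exact h.mono Ioi_subset_Ici_self

/-- `I` is continuous on `[1, ∞)` (hence so is `S`, Lemma 2.11 (iii): "from (2.19), `S(t)` is
continuous"). [cite: Nicolas2022HC, Lemma 2.11 (iii) (proof: continuity of S from (2.19))] -/
theorem continuousOn_primeIntegral : ContinuousOn primeIntegral (Ici 1) := by
  intro x hx
  have hx1 : (1 : ℝ) ≤ x := hx
  have hx1' : (1 : ℝ) ≤ x + 1 := by linarith
  have h : IntervalIntegrable (fun u : ℝ ↦ 1 - ψ u / u) volume 1 (x + 1) :=
    intervalIntegrable_one_sub_psi_div one_pos hx1'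
  -- `I` is the primitive of a locally integrable function on `[1, ∞)`
  have hprim : ContinuousOn (fun y ↦ ∫ u in (1 : ℝ)..y, (1 - ψ u / u)) (Icc 1 (x + 1)) := by
    have := intervalIntegral.continuousOn_primitive_interval' h
      (by rw [Set.uIcc_of_le hx1']; exact ⟨le_rfl, hx1'⟩)
    rwa [Set.uIcc_of_le hx1'] at this
  have hcw : ContinuousWithinAt primeIntegral (Icc 1 (x + 1)) x := hprim x ⟨hx1, by linarith⟩
  refine hcw.mono_of_mem_nhdsWithin ?_
  have : Iio (x + 1) ∈ 𝓝 x := Iio_mem_nhds (by linarith)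
  filter_upwards [self_mem_nhdsWithin, mem_nhdsWithin_of_mem_nhds this] with s hs hs'
  exact ⟨hs, hs'.le⟩

end Nicolas2022

end Literature.NumberTheory.LFunctions

end
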